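import Summits.KontsevichZagierPeriods.KontsevichZagierPeriods.Theorems.FermatIsogenyDeepWordSectorBP3

/-! # `FermatIsogenyDeepWordSectorBP4` — part 4/7 of the mechanical ≤400-line split of `B_src.lean` (sha256 9cb321caf3c881c0…)
Source: decomp-kz lens-5 g22 DeepWordSectorB.lean v4 @d2f1e37a (levels 3/4 closed hypothesis-free, Dirichlet move proved, level 6 from the linear rung; critic CLEARED g7-5 l.1397 / g7-7 l.1406); --supports stmt-KontsevichZagierPeriods-3898.
Split by census-1 g10 `gen/splitlean.py`: scopes re-opened with their `open`/`variable`/`set_option` context; mathematics and declaration order unchanged. -/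

namespace Summit.KontsevichZagierPeriods.FermatIsogeny.DeepTargets
open Literature.NumberTheory.Transcendental MeasureTheory
open Summit.KontsevichZagierPeriods.KontsevichZagierPeriods.Theses.FermatIsogeny (BetaLinearSector BetaProductSector FermatSectorComplete)

open Literature.NumberTheory.Transcendental MeasureTheory in
open Summit.KontsevichZagierPeriods.KontsevichZagierPeriods.Theses.FermatIsogeny (BetaLinearSector BetaProductSector FermatSectorComplete) in
/-- Auxiliary step `isAlgebraic_sqrt_two`: is Algebraic sqrt two. [bookkeeping] -/
private theorem isAlgebraic_sqrt_two : IsAlgebraic ℚ (Real.sqrt 2) := by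
  have h := KZ.isAlgebraic_natCast_rpow_ratCast 2 (1/2); convert h using 1; rw [Real.sqrt_eq_rpow]; push_cast; norm_num

/-- Rational numbers are real algebraic. [bookkeeping] -/
private theorem isAlgebraic_ratCast (x : ℚ) : IsAlgebraic ℚ (x : ℝ) := by
  have h := isAlgebraic_algebraMap (R := ℚ) (A := ℝ) x
  rwa [eq_ratCast] at h

/-- Auxiliary step `isAlgebraic_two`: is Algebraic two. [bookkeeping] -/
private theorem isAlgebraic_two : IsAlgebraic ℚ (2:ℝ) := by
  simpa using isAlgebraic_ratCast 2

/-!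
### ADDENDUM 5 — LEVEL 4 CLOSED: `boxChain_four : ∀ k, BoxChain k 4 (SameType 4)` UNCONDITIONALLY

The sixteen level-4 letters `β(i/4, j/4)` are `κ(c)·κ(√2)^s·X^x Y^y Z^z` in `P` with generators `X = β(½,½)` (`= π`),
`Y = β(¼,½)`, `Z = β(¾,¾)`: the units by `bcl_rat_one`, `β(¼,¼) = κ(√2)·Y` and `β(½,¾) = β(¾,½) = κ(√2)·Z` by LEGENDRE
(`bcl_dup` at `a = ¼, ¾`), `β(¼,¾) = β(¾,¼) = κ(√2)·X` by Dirichlet `(½,¼,¾)` + the relation, and the one relation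
`Y·Z = κ(2√2)·X` by Dirichlet `(¼,½,½)` + Legendre.  DKO type 0 at level 4 is `n₁ = n₃ ∧ n₂ + 2n₃ = 0`
(`hodgeType_four_iff`), i.e. the two count identities `#X + #Z`, `#Y − #Z` agree (`sameType_four_iff`) — exactly the
hypotheses of the level-3 normal form `nf3`, reused verbatim.  Hence `BoxChain k 4 (SameType 4)` for every `k`, so
`ChudnovskyGammaQuarter → ∀ k, BetaWordSectorLevel k 4`, and crux 3898's `φ(N) ≤ 2` base range is down to the single finite
chain statement `BoxChain 2 6 (SameType 6)`.
-/

section LevelFourChains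

/-- Auxiliary step `isAlgebraic_twoSqrtTwo`: is Algebraic two Sqrt Two. [bookkeeping] -/
theorem isAlgebraic_twoSqrtTwo : IsAlgebraic ℚ (2 * Real.sqrt 2) := isAlgebraic_two.mul isAlgebraic_sqrt_two

/-- Auxiliary step `twoSqrtTwo_pos`: two Sqrt Two pos. [bookkeeping] -/
theorem twoSqrtTwo_pos : 0 < 2 * Real.sqrt 2 := by positivity

/-- `κ(2√2)` and `κ((2√2)⁻¹)`. [bookkeeping] -/
noncomputable def kcT : KZ.FormalPeriodRing := kc (2 * Real.sqrt 2) isAlgebraic_twoSqrtTwo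
/-- Auxiliary definition `kcTi`: kc Ti. [bookkeeping] -/
noncomputable def kcTi : KZ.FormalPeriodRing := kc (2 * Real.sqrt 2)⁻¹ isAlgebraic_twoSqrtTwo.inv

/-- Auxiliary step `evalP_kcT`: eval P kc T. [bookkeeping] -/
@[simp] theorem evalP_kcT : KZ.evalP kcT = 2 * Real.sqrt 2 := evalP_kc _ _

/-- Auxiliary step `kcT_mul_kcTi`: kc T mul kc Ti. [bookkeeping] -/
theorem kcT_mul_kcTi : kcT * kcTi = 1 := kc_mul_kc_inv _ twoSqrtTwo_pos.ne'

/-! #### the unit letters and the symmetric letters -/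

/-- Auxiliary step `bcl_quarter_one`: bcl quarter one. [bookkeeping] -/
theorem bcl_quarter_one : bcl (1/4) 1 = kcQ 4 := by
  rw [bcl_rat_one (1/4) (by norm_num), kcQ]; exact kc_congr _ _ (by norm_num)

/-- Auxiliary step `bcl_one_quarter`: bcl one quarter. [bookkeeping] -/
theorem bcl_one_quarter : bcl 1 (1/4) = kcQ 4 := by
  rw [bcl_symm betaReflectionMove_holds 1 (1/4) one_pos (by norm_num), bcl_quarter_one]

/-- Auxiliary step `bcl_half_one'`: bcl half one'. [bookkeeping] -/
theorem bcl_half_one' : bcl (1/2) 1 = kcQ 2 := by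
  rw [bcl_rat_one (1/2) (by norm_num), kcQ]; exact kc_congr _ _ (by norm_num)

/-- Auxiliary step `bcl_one_half'`: bcl one half'. [bookkeeping] -/
theorem bcl_one_half' : bcl 1 (1/2) = kcQ 2 := by
  rw [bcl_symm betaReflectionMove_holds 1 (1/2) one_pos (by norm_num), bcl_half_one']

/-- Auxiliary step `bcl_threeQuarters_one`: bcl three Quarters one. [bookkeeping] -/
theorem bcl_threeQuarters_one : bcl (3/4) 1 = kcQ (4/3) := by
  rw [bcl_rat_one (3/4) (by norm_num), kcQ]; exact kc_congr _ _ (by norm_num)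

/-- Auxiliary step `bcl_one_threeQuarters`: bcl one three Quarters. [bookkeeping] -/
theorem bcl_one_threeQuarters : bcl 1 (3/4) = kcQ (4/3) := by
  rw [bcl_symm betaReflectionMove_holds 1 (3/4) one_pos (by norm_num), bcl_threeQuarters_one]

/-- Auxiliary step `bcl_half_quarter`: bcl half quarter. [bookkeeping] -/
theorem bcl_half_quarter : bcl (1/2) (1/4) = bcl (1/4) (1/2) :=
  bcl_symm betaReflectionMove_holds (1/2) (1/4) (by norm_num) (by norm_num)

/-- Auxiliary step `bcl_half_threeQuarters`: bcl half three Quarters. [bookkeeping] -/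
theorem bcl_half_threeQuarters : bcl (1/2) (3/4) = kcS * bcl (3/4) (3/4) := by
  rw [bcl_symm betaReflectionMove_holds (1/2) (3/4) (by norm_num) (by norm_num), bcl_threeQuarters_half]

/-- **The level-4 relation in `P`**: `β(¼,½)·β(¾,¾) = κ(2√2)·β(½,½)` — Dirichlet at `(¼,½,½)`, the unit letter `β(¼,1) = κ(4)`
and Legendre at `¾`. [this node] -/
theorem dirichlet_four_rel : bcl (1/4) (1/2) * bcl (3/4) (3/4) = kcT * bcl (1/2) (1/2) := by
  have h := bcl_dirichlet (1/4) (1/2) (1/2) (by norm_num) (by norm_num) (by norm_num)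
  rw [show (1/4:ℚ) + 1/2 = 3/4 by norm_num, show (1/2:ℚ) + 1/2 = 1 by norm_num, bcl_quarter_one,
    bcl_threeQuarters_half] at h
  have hS0 : Real.sqrt 2 ≠ 0 := (Real.sqrt_pos.mpr two_pos).ne'
  have hSi : kc (Real.sqrt 2)⁻¹ isAlgebraic_sqrt_two.inv * kcS = 1 := by
    rw [mul_comm]; exact kc_mul_kc_inv _ hS0
  have hk : kc (Real.sqrt 2)⁻¹ isAlgebraic_sqrt_two.inv * kcQ 4 = kcT := by
    rw [kcQ, kcT, ← kc_mul]
    refine kc_congr _ _ ?_; have h2 : Real.sqrt 2 ^ 2 = 2 := Real.sq_sqrt zero_le_two; push_cast; rw [inv_mul_eq_div, div_eq_iff hS0]; linear_combination (-2:ℝ) * h2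
  calc bcl (1/4) (1/2) * bcl (3/4) (3/4)
        = (kc (Real.sqrt 2)⁻¹ isAlgebraic_sqrt_two.inv * kcS) * (bcl (1/4) (1/2) * bcl (3/4) (3/4)) := by
          rw [hSi, one_mul]
    _ = kc (Real.sqrt 2)⁻¹ isAlgebraic_sqrt_two.inv * (kcS * bcl (3/4) (3/4) * bcl (1/4) (1/2)) := by ring
    _ = kc (Real.sqrt 2)⁻¹ isAlgebraic_sqrt_two.inv * (bcl (1/2) (1/2) * kcQ 4) := by rw [h]
    _ = (kc (Real.sqrt 2)⁻¹ isAlgebraic_sqrt_two.inv * kcQ 4) * bcl (1/2) (1/2) := by ring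
    _ = kcT * bcl (1/2) (1/2) := by rw [hk]

/-- … and on values: `B(¼,½)·B(¾,¾) = 2√2·B(½,½)` (`= 2√2·π`). [this node] -/
theorem dirichlet_four_rel_values : bval (1/4) (1/2) * bval (3/4) (3/4) = (2 * Real.sqrt 2) * bval (1/2) (1/2) := by
  have h := congrArg KZ.evalP dirichlet_four_rel; rw [map_mul, map_mul, evalP_kcT] at h; exact h

/-- `β(¼,¾) = κ(√2)·β(½,½)` (`Γ(¼)Γ(¾) = √2·π`): Dirichlet at `(½,¼,¾)`, the unit letter `β(½,1) = κ(2)` and the relation.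
[this node] -/
theorem bcl_quarter_threeQuarters : bcl (1/4) (3/4) = kcS * bcl (1/2) (1/2) := by
  have h := bcl_dirichlet (1/2) (1/4) (3/4) (by norm_num) (by norm_num) (by norm_num)
  rw [show (1/2:ℚ) + 1/4 = 3/4 by norm_num, show (1/4:ℚ) + 3/4 = 1 by norm_num, bcl_half_quarter, bcl_half_one'] at h
  have h21 : kcQ 2 * kcQ (1/2) = 1 := by
    rw [← kcQ_mul, show (2:ℚ) * (1/2) = 1 by norm_num, kcQ_one]
  have hk : kcQ (1/2) * kcT = kcS := by
    rw [kcQ, kcT, kcS, ← kc_mul]; exact kc_congr _ _ (by push_cast; ring)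
  calc bcl (1/4) (3/4) = bcl (1/4) (3/4) * (kcQ 2 * kcQ (1/2)) := by rw [h21, mul_one]
    _ = (bcl (1/4) (3/4) * kcQ 2) * kcQ (1/2) := by ring
    _ = (bcl (3/4) (3/4) * bcl (1/4) (1/2)) * kcQ (1/2) := by rw [← h]
    _ = kcQ (1/2) * (bcl (1/4) (1/2) * bcl (3/4) (3/4)) := by ring
    _ = kcQ (1/2) * (kcT * bcl (1/2) (1/2)) := by rw [dirichlet_four_rel]
    _ = kcS * bcl (1/2) (1/2) := by rw [← mul_assoc, hk]

/-- Auxiliary step `bcl_threeQuarters_quarter`: bcl three Quarters quarter. [bookkeeping] -/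
theorem bcl_threeQuarters_quarter : bcl (3/4) (1/4) = kcS * bcl (1/2) (1/2) := by
  rw [bcl_symm betaReflectionMove_holds (3/4) (1/4) (by norm_num) (by norm_num), bcl_quarter_threeQuarters]

/-! #### the sixteen level-4 letters -/

end LevelFourChains

end Summit.KontsevichZagierPeriods.FermatIsogeny.DeepTargets
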